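import Summits.ResolutionOfSingularities.ResolutionOfSingularities.Theorems.FrobeniusLadderFInjectiveMacaulayficationToricChartFedder
import Literature.AlgebraicGeometry.Resolution.AffineBlowupAlgebra
import Mathlib.RingTheory.Localization.Away.Basic
import HarnessLib

/-!
# Monomial chart presentation (C1), part 1: exponent bookkeeping and the range of the chart map
(crux `FInjectiveMacaulayfication`, CN engine chain CRUX-PLAN v6 §1.3, piece (C1) `MonomialChartPresentation`)

[OURS · L1 W4.5a] Support file for crux stmt-ResolutionOfSingularities-15315.  Setting (v6 §1.3): `V` a unimodular exponent matrix with
rows `v_l` (the chart's rays), `E e = (⟨v_l, e⟩)_l` its exponent map (`θ x^e = Y^{E e}`, `ToricChartFedder.theta_monomial`), `m` the chart's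
vertex of the blown-up monomial ideal `I_A = (x^e : e ∈ A)`, and `a i = m + u_i ∈ A` the exponents with `E (a i) = E m + e_i` (the chart
coordinates are `Y_i = x^{a i}/x^m`).  For `R̄ = k[X]/(f)` and `u = x̄^m` the chart map is
`Ψ : k[Y] → R̄[1/u]`, `Y_i ↦ x̄^{a i}/u`.  This file: §1 the exponent identities derived from `E (a i) = E m + e_i` by injectivity of `E`
(`sum_col_smul_a`, `exists_repr_of_le`, `expMap_eps`); §2 `Ψ ∘ θ = (x ↦ x̄/1)` (`psi_theta`) and the RANGE of `Ψ` is the affine blow-up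
algebra `R̄[I_A R̄/u]` (`range_psi_eq_blowupAlgebra`).  Part 2 (kernel `= (g)`, the iso) is the companion file.  No definition is declared;
AI-written, weaker than expert review; no statement of [claim: Hironaka2017] is used. [folklore: Cox–Little–Schenck §2.3/§10, affine
toric charts of monomial blow-ups]
-/

-- single-problem summit: the doubled namespace component is forced
set_option linter.dupNamespace false

noncomputable section

namespace Summit.ResolutionOfSingularities.ResolutionOfSingularities.Theorems.FInjectiveMacaulayfication.MonomialChartPresentationRange

open MvPolynomial
open Summit.ResolutionOfSingularities.ResolutionOfSingularities.Theorems.FInjectiveMacaulayfication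

variable {n : ℕ}

/-! ## §1 Exponent bookkeeping -/

/-- `E` is additive. [folklore] -/
theorem expMap_add (V : Matrix (Fin n) (Fin n) ℕ) (e e' : Fin n →₀ ℕ) :
    (Finsupp.equivFunOnFinite.symm (V.mulVec ⇑(e + e')) : Fin n →₀ ℕ) =
      Finsupp.equivFunOnFinite.symm (V.mulVec ⇑e) + Finsupp.equivFunOnFinite.symm (V.mulVec ⇑e') := by
  ext l
  rw [Finsupp.add_apply, ToricChartFedder.expMap_apply, ToricChartFedder.expMap_apply, ToricChartFedder.expMap_apply,
    ← Finset.sum_add_distrib]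
  refine Finset.sum_congr rfl fun j _ => ?_
  rw [Finsupp.add_apply, mul_add]

/-- `E` commutes with scalar multiples. [folklore] -/
theorem expMap_smul (V : Matrix (Fin n) (Fin n) ℕ) (c : ℕ) (e : Fin n →₀ ℕ) :
    (Finsupp.equivFunOnFinite.symm (V.mulVec ⇑(c • e)) : Fin n →₀ ℕ) = c • Finsupp.equivFunOnFinite.symm (V.mulVec ⇑e) := by
  ext l
  rw [Finsupp.smul_apply, ToricChartFedder.expMap_apply, ToricChartFedder.expMap_apply, smul_eq_mul, Finset.mul_sum]
  refine Finset.sum_congr rfl fun j _ => ?_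
  rw [Finsupp.smul_apply, smul_eq_mul]
  ring

/-- `E` commutes with finite sums. [folklore] -/
theorem expMap_sum (V : Matrix (Fin n) (Fin n) ℕ) {ι : Type} (s : Finset ι) (e : ι → (Fin n →₀ ℕ)) :
    (Finsupp.equivFunOnFinite.symm (V.mulVec ⇑(∑ i ∈ s, e i)) : Fin n →₀ ℕ) =
      ∑ i ∈ s, Finsupp.equivFunOnFinite.symm (V.mulVec ⇑(e i)) := by
  classical
  induction s using Finset.induction_on with
  | empty =>
    ext l
    rw [Finset.sum_empty, Finset.sum_empty, ToricChartFedder.expMap_apply]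
    simp
  | insert i s hi ih => rw [Finset.sum_insert hi, Finset.sum_insert hi, expMap_add, ih]

/-- `E (e_j)` is the `j`-th column of `V`: `E (e_j) = Σ_i V i j • e_i`. [folklore] -/
theorem expMap_single (V : Matrix (Fin n) (Fin n) ℕ) (j : Fin n) :
    (Finsupp.equivFunOnFinite.symm (V.mulVec ⇑(Finsupp.single j 1)) : Fin n →₀ ℕ) =
      ∑ i : Fin n, V i j • Finsupp.single i 1 := by
  classical
  ext l
  rw [ToricChartFedder.expMap_apply, Finsupp.finsetSum_apply, Finset.sum_eq_single j, Finset.sum_eq_single l]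
  · simp
  · intro i _ hil
    simp [hil]
  · intro h; exact absurd (Finset.mem_univ l) h
  · intro j' _ hj'
    simp [hj'.symm]
  · intro h; exact absurd (Finset.mem_univ j) h

section Identities

variable (V : Matrix (Fin n) (Fin n) ℕ) (hV : IsUnit (V.map (Nat.cast : ℕ → ℤ)).det) (m : Fin n →₀ ℕ)
  (a : Fin n → (Fin n →₀ ℕ))
  (hgen : ∀ i : Fin n, (Finsupp.equivFunOnFinite.symm (V.mulVec ⇑(a i)) : Fin n →₀ ℕ) =
    Finsupp.equivFunOnFinite.symm (V.mulVec ⇑m) + Finsupp.single i 1)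
include hV hgen

/-- **(a) The coordinate `x_j` in chart coordinates**: `Σ_i V i j • a i = e_j + (Σ_i V i j) • m` (i.e. `x_j · (x^m)^{Σᵢ V i j} = ∏ᵢ (x^{a i})^{V i j}`).
[folklore] -/
theorem sum_col_smul_a (j : Fin n) :
    ∑ i : Fin n, V i j • a i = Finsupp.single j 1 + (∑ i : Fin n, V i j) • m := by
  apply ToricChartFedder.expMap_injective V hV
  simp only
  rw [expMap_sum, expMap_add, expMap_smul, expMap_single, Finset.sum_smul]
  simp_rw [expMap_smul, hgen, smul_add]
  rw [Finset.sum_add_distrib, add_comm]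

/-- **(b) Monomials of the centre in chart coordinates**: if `E m ≤ E e` then, with `c = E e - E m`,
`Σ_i c_i • a i + m = e + |c| • m` (i.e. `x^e/x^m = ∏ᵢ (x^{a i}/x^m)^{c_i}`). [folklore] -/
theorem exists_repr_of_le (e : Fin n →₀ ℕ)
    (hle : (Finsupp.equivFunOnFinite.symm (V.mulVec ⇑m) : Fin n →₀ ℕ) ≤ Finsupp.equivFunOnFinite.symm (V.mulVec ⇑e)) :
    ∃ c : Fin n → ℕ, ∑ i : Fin n, c i • a i + m = e + (∑ i : Fin n, c i) • m := by
  set c : Fin n →₀ ℕ := Finsupp.equivFunOnFinite.symm (V.mulVec ⇑e) - Finsupp.equivFunOnFinite.symm (V.mulVec ⇑m)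
    with hc
  refine ⟨c, ?_⟩
  apply ToricChartFedder.expMap_injective V hV
  simp only
  rw [expMap_add, expMap_sum, expMap_add, expMap_smul, Finset.sum_smul]
  simp_rw [expMap_smul, hgen, smul_add]
  rw [Finset.sum_add_distrib]
  have hcsum : ∑ i : Fin n, c i • (Finsupp.single i 1 : Fin n →₀ ℕ) = c := by
    ext l
    rw [Finsupp.finsetSum_apply, Finset.sum_eq_single l]
    · simp
    · intro i _ hil; simp [hil]
    · intro h; exact absurd (Finset.mem_univ l) h
  rw [hcsum, hc, add_assoc, tsub_add_cancel_of_le hle, add_comm]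

omit hV in
/-- **(K) Exponents of the cleared numerator**: for `|c| ≤ D`, `ε_c = Σ_i c_i • a i + (D - |c|) • m` satisfies `E ε_c = D • E m + c`
(so `θ x^{ε_c} = Y^{D • E m} · Y^c`). [folklore] -/
theorem expMap_eps (c : Fin n →₀ ℕ) (D : ℕ) (hD : ∑ i : Fin n, c i ≤ D) :
    (Finsupp.equivFunOnFinite.symm (V.mulVec ⇑(∑ i : Fin n, c i • a i + (D - ∑ i : Fin n, c i) • m)) : Fin n →₀ ℕ) =
      D • Finsupp.equivFunOnFinite.symm (V.mulVec ⇑m) + c := by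
  rw [expMap_add, expMap_sum, expMap_smul]
  simp_rw [expMap_smul, hgen, smul_add]
  rw [Finset.sum_add_distrib, ← Finset.sum_smul]
  have hcsum : ∑ i : Fin n, c i • (Finsupp.single i 1 : Fin n →₀ ℕ) = c := by
    ext l
    rw [Finsupp.finsetSum_apply, Finset.sum_eq_single l]
    · simp
    · intro i _ hil; simp [hil]
    · intro h; exact absurd (Finset.mem_univ l) h
  rw [hcsum, add_right_comm, ← add_smul, add_tsub_cancel_of_le hD]

end Identities

/-! ## §2 The chart map `Ψ : Y_i ↦ x̄^{a i}/x̄^m` into `R̄[1/x̄^m]`: values on monomials, `Ψ ∘ θ`, range -/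

section Chart

variable {k : Type} [Field k] (f : MvPolynomial (Fin n) k) (V : Matrix (Fin n) (Fin n) ℕ)
  (hV : IsUnit (V.map (Nat.cast : ℕ → ℤ)).det) (m : Fin n →₀ ℕ) (a : Fin n → (Fin n →₀ ℕ))
  (hgen : ∀ i : Fin n, (Finsupp.equivFunOnFinite.symm (V.mulVec ⇑(a i)) : Fin n →₀ ℕ) =
    Finsupp.equivFunOnFinite.symm (V.mulVec ⇑m) + Finsupp.single i 1)

/-- **`Ψ` on monomials**: `Ψ(Y^c) · (x̄^m/1)^{|c|} = x̄^{Σ_i c_i • a i}/1`. [folklore] -/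
theorem psi_monomial_mul_pow (c : Fin n →₀ ℕ) :
    aeval (fun i : Fin n => algebraMap (MvPolynomial (Fin n) k ⧸ Ideal.span {f})
        (Localization.Away (Ideal.Quotient.mk (Ideal.span {f}) (monomial m (1 : k))))
        (Ideal.Quotient.mk (Ideal.span {f}) (monomial (a i) (1 : k))) *
      IsLocalization.Away.invSelf (Ideal.Quotient.mk (Ideal.span {f}) (monomial m (1 : k)))) (monomial c (1 : k)) *
      (algebraMap (MvPolynomial (Fin n) k ⧸ Ideal.span {f})
        (Localization.Away (Ideal.Quotient.mk (Ideal.span {f}) (monomial m (1 : k))))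
        (Ideal.Quotient.mk (Ideal.span {f}) (monomial m (1 : k)))) ^ (∑ i : Fin n, c i) =
      algebraMap (MvPolynomial (Fin n) k ⧸ Ideal.span {f})
        (Localization.Away (Ideal.Quotient.mk (Ideal.span {f}) (monomial m (1 : k))))
        (Ideal.Quotient.mk (Ideal.span {f}) (monomial (∑ i : Fin n, c i • a i) (1 : k))) := by
  set R := MvPolynomial (Fin n) k ⧸ Ideal.span {f}
  set u : R := Ideal.Quotient.mk (Ideal.span {f}) (monomial m (1 : k)) with hu
  set L := Localization.Away u
  rw [aeval_monomial, map_one, one_mul, Finsupp.prod_fintype _ _ (fun i => by simp)]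
  simp_rw [mul_pow]
  rw [Finset.prod_mul_distrib, Finset.prod_pow_eq_pow_sum, mul_assoc, ← mul_pow, mul_comm (IsLocalization.Away.invSelf u),
    IsLocalization.Away.mul_invSelf, one_pow, mul_one]
  simp_rw [← map_pow]
  rw [← map_prod, ← map_prod, monomial_sum_index, C_1, one_mul]
  congr 2
  refine Finset.prod_congr rfl fun i _ => ?_
  rw [monomial_pow, one_pow]

include hV hgen

/-- **(a) `Ψ (θ X_j) = x̄_j/1`**: the chart map composed with `θ` is the structure map `k[X] → R̄ → R̄[1/x̄^m]`, on variables. [folklore] -/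
theorem psi_theta_X (j : Fin n) :
    aeval (fun i : Fin n => algebraMap (MvPolynomial (Fin n) k ⧸ Ideal.span {f})
        (Localization.Away (Ideal.Quotient.mk (Ideal.span {f}) (monomial m (1 : k))))
        (Ideal.Quotient.mk (Ideal.span {f}) (monomial (a i) (1 : k))) *
      IsLocalization.Away.invSelf (Ideal.Quotient.mk (Ideal.span {f}) (monomial m (1 : k))))
      (∏ i : Fin n, (X i : MvPolynomial (Fin n) k) ^ V i j) =
      algebraMap (MvPolynomial (Fin n) k ⧸ Ideal.span {f})
        (Localization.Away (Ideal.Quotient.mk (Ideal.span {f}) (monomial m (1 : k))))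
        (Ideal.Quotient.mk (Ideal.span {f}) (X j)) := by
  set R := MvPolynomial (Fin n) k ⧸ Ideal.span {f}
  set u : R := Ideal.Quotient.mk (Ideal.span {f}) (monomial m (1 : k)) with hu
  set L := Localization.Away u
  -- `∏ᵢ Yᵢ ^ V i j = monomial (col j) 1` with `col j = E e_j`
  have hcol : (∏ i : Fin n, (X i : MvPolynomial (Fin n) k) ^ V i j) =
      monomial (Finsupp.equivFunOnFinite.symm (V.mulVec ⇑(Finsupp.single j 1))) (1 : k) := by
    rw [← ToricChartFedder.theta_monomial V (Finsupp.single j 1) (1 : k)]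
    change _ = aeval _ (X j)
    rw [aeval_X]
  set c : Fin n →₀ ℕ := Finsupp.equivFunOnFinite.symm (V.mulVec ⇑(Finsupp.single j 1)) with hc_def
  have hc : ∀ i, c i = V i j := fun i => by
    rw [hc_def, ToricChartFedder.expMap_apply, Finset.sum_eq_single j]
    · rw [Finsupp.single_eq_same, mul_one]
    · intro j' _ hj'; rw [Finsupp.single_eq_of_ne hj', mul_zero]
    · intro h; exact absurd (Finset.mem_univ j) h
  have hU : IsUnit (algebraMap R L u ^ (∑ i : Fin n, c i)) := (IsLocalization.Away.algebraMap_isUnit u).pow _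
  rw [hcol]
  refine hU.mul_left_injective ?_
  simp only
  rw [psi_monomial_mul_pow f m a c]
  have hsum : ∑ i : Fin n, c i • a i = Finsupp.single j 1 + (∑ i : Fin n, c i) • m := by
    have h1 : ∑ i : Fin n, c i • a i = ∑ i : Fin n, V i j • a i := Finset.sum_congr rfl fun i _ => by rw [hc i]
    have h2 : ∑ i : Fin n, c i = ∑ i : Fin n, V i j := Finset.sum_congr rfl fun i _ => hc i
    rw [h1, h2]
    exact sum_col_smul_a V hV m a hgen j
  have hmm : (monomial (Finsupp.single j 1 + (∑ i : Fin n, c i) • m) (1 : k) : MvPolynomial (Fin n) k) =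
      monomial (Finsupp.single j 1) 1 * (monomial m (1 : k)) ^ (∑ i : Fin n, c i) := by
    rw [monomial_pow, one_pow, monomial_mul, mul_one]
  rw [hsum, hmm, map_mul, map_mul, map_pow, map_pow]
  rfl

/-- **`Ψ ∘ θ` is the structure map**: `Ψ (θ q) = q̄/1` for every `q ∈ k[X]`. [folklore] -/
theorem psi_theta (q : MvPolynomial (Fin n) k) :
    aeval (fun i : Fin n => algebraMap (MvPolynomial (Fin n) k ⧸ Ideal.span {f})
        (Localization.Away (Ideal.Quotient.mk (Ideal.span {f}) (monomial m (1 : k))))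
        (Ideal.Quotient.mk (Ideal.span {f}) (monomial (a i) (1 : k))) *
      IsLocalization.Away.invSelf (Ideal.Quotient.mk (Ideal.span {f}) (monomial m (1 : k))))
      (aeval (fun j : Fin n => ∏ i : Fin n, (X i : MvPolynomial (Fin n) k) ^ V i j) q) =
      algebraMap (MvPolynomial (Fin n) k ⧸ Ideal.span {f})
        (Localization.Away (Ideal.Quotient.mk (Ideal.span {f}) (monomial m (1 : k))))
        (Ideal.Quotient.mk (Ideal.span {f}) q) := by
  set R := MvPolynomial (Fin n) k ⧸ Ideal.span {f}
  set u : R := Ideal.Quotient.mk (Ideal.span {f}) (monomial m (1 : k)) with hu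
  set L := Localization.Away u
  set Ψ : MvPolynomial (Fin n) k →ₐ[k] L := aeval (fun i : Fin n => algebraMap R L
    (Ideal.Quotient.mk (Ideal.span {f}) (monomial (a i) (1 : k))) * IsLocalization.Away.invSelf u) with hΨ
  set θ : MvPolynomial (Fin n) k →ₐ[k] MvPolynomial (Fin n) k :=
    aeval (fun j : Fin n => ∏ i : Fin n, (X i : MvPolynomial (Fin n) k) ^ V i j) with hθ
  have hcomp : Ψ.comp θ = (IsScalarTower.toAlgHom k R L).comp (Ideal.Quotient.mkₐ k (Ideal.span {f})) := by
    refine MvPolynomial.algHom_ext fun j => ?_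
    rw [AlgHom.comp_apply, AlgHom.comp_apply, hθ, aeval_X, hΨ, psi_theta_X f V hV m a hgen j,
      Ideal.Quotient.mkₐ_eq_mk, IsScalarTower.coe_toAlgHom']
  have h := DFunLike.congr_fun hcomp q
  rw [AlgHom.comp_apply, AlgHom.comp_apply, Ideal.Quotient.mkₐ_eq_mk, IsScalarTower.coe_toAlgHom'] at h
  exact h

/-- **The range of `Ψ` is the affine blow-up algebra `R̄[I_A R̄ / x̄^m]`** (`I_A = (x^e : e ∈ A)`, `m ∈ A`, `a i ∈ A`, and the chart
inequalities `E m ≤ E e` for `e ∈ A`). [folklore] -/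
theorem range_psi_eq_blowupAlgebra (A : Finset (Fin n →₀ ℕ)) (haA : ∀ i, a i ∈ A)
    (hge : ∀ e ∈ A, (Finsupp.equivFunOnFinite.symm (V.mulVec ⇑m) : Fin n →₀ ℕ) ≤
      Finsupp.equivFunOnFinite.symm (V.mulVec ⇑e)) :
    Set.range (aeval (fun i : Fin n => algebraMap (MvPolynomial (Fin n) k ⧸ Ideal.span {f})
        (Localization.Away (Ideal.Quotient.mk (Ideal.span {f}) (monomial m (1 : k))))
        (Ideal.Quotient.mk (Ideal.span {f}) (monomial (a i) (1 : k))) *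
      IsLocalization.Away.invSelf (Ideal.Quotient.mk (Ideal.span {f}) (monomial m (1 : k)))) :
        MvPolynomial (Fin n) k → Localization.Away (Ideal.Quotient.mk (Ideal.span {f}) (monomial m (1 : k)))) =
      (Literature.AlgebraicGeometry.Resolution.blowupAlgebra
        (Ideal.span ((fun e : Fin n →₀ ℕ => Ideal.Quotient.mk (Ideal.span {f}) (monomial e (1 : k))) '' (A : Set _)))
        (Ideal.Quotient.mk (Ideal.span {f}) (monomial m (1 : k))) : Set _) := by
  set R := MvPolynomial (Fin n) k ⧸ Ideal.span {f}
  set u : R := Ideal.Quotient.mk (Ideal.span {f}) (monomial m (1 : k)) with hu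
  set L := Localization.Away u
  set Ψ : MvPolynomial (Fin n) k →ₐ[k] L := aeval (fun i : Fin n => algebraMap R L
    (Ideal.Quotient.mk (Ideal.span {f}) (monomial (a i) (1 : k))) * IsLocalization.Away.invSelf u) with hΨ
  set I : Ideal R := Ideal.span ((fun e : Fin n →₀ ℕ => Ideal.Quotient.mk (Ideal.span {f}) (monomial e (1 : k))) ''
    (A : Set _)) with hI
  set B := Literature.AlgebraicGeometry.Resolution.blowupAlgebra I u with hB
  -- the range as an `R̄`-subalgebra (it contains `R̄` by `psi_theta`)
  have hRmem : ∀ r : R, algebraMap R L r ∈ Set.range Ψ := fun r => by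
    obtain ⟨q, rfl⟩ := Ideal.Quotient.mk_surjective r
    exact ⟨_, psi_theta f V hV m a hgen q⟩
  let S : Subalgebra R L :=
    { carrier := Set.range Ψ
      mul_mem' := by
        rintro _ _ ⟨x, rfl⟩ ⟨y, rfl⟩
        exact ⟨x * y, map_mul Ψ x y⟩
      add_mem' := by
        rintro _ _ ⟨x, rfl⟩ ⟨y, rfl⟩
        exact ⟨x + y, map_add Ψ x y⟩
      algebraMap_mem' := hRmem }
  apply le_antisymm
  · -- `range Ψ ⊆ B`: images of variables are generators, constants come from `R̄`
    rintro _ ⟨q, rfl⟩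
    induction q using MvPolynomial.induction_on with
    | C c =>
      rw [hΨ, aeval_C, IsScalarTower.algebraMap_apply k R L]
      exact Subalgebra.algebraMap_mem B _
    | add p q hp hq => rw [map_add]; exact Subalgebra.add_mem B hp hq
    | mul_X p i hp =>
      rw [map_mul, hΨ, aeval_X]
      refine Subalgebra.mul_mem B hp ?_
      exact Literature.AlgebraicGeometry.Resolution.div_mem_blowupAlgebra I u
        (Ideal.subset_span ⟨a i, haA i, rfl⟩)
  · -- `B ⊆ range Ψ`: `B = adjoin R̄ gens` and every generator `x/u`, `x ∈ I`, lies in the `R̄`-subalgebra `S`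
    change (B : Set L) ⊆ (S : Set L)
    refine SetLike.coe_subset_coe.mpr (Algebra.adjoin_le ?_ : B ≤ S)
    rintro _ ⟨x, hx, rfl⟩
    -- induction over `x ∈ I = span (monomials of A)`
    refine Submodule.span_induction ?_ ?_ ?_ ?_ hx
    · rintro _ ⟨e, he, rfl⟩
      obtain ⟨c, hc⟩ := exists_repr_of_le V hV m a hgen e (hge e he)
      -- `x̄^e/u = Ψ(Y^c)`: from `Ψ(Y^c) u^{|c|} = x̄^{Σ cᵢaᵢ}/1` and `x^{Σ cᵢaᵢ} x^m = x^e (x^m)^{|c|}`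
      set c' : Fin n →₀ ℕ := Finsupp.equivFunOnFinite.symm c with hc'
      have hcc : ∀ i, c' i = c i := fun i => by rw [hc', Finsupp.coe_equivFunOnFinite_symm]
      have h1 := psi_monomial_mul_pow f m a c'
      have hexp : ∑ i : Fin n, c' i • a i + m = e + (∑ i : Fin n, c' i) • m := by
        simp_rw [hcc]; exact hc
      have hR : Ideal.Quotient.mk (Ideal.span {f}) (monomial (∑ i : Fin n, c' i • a i) (1 : k)) * u =
          Ideal.Quotient.mk (Ideal.span {f}) (monomial e (1 : k)) * u ^ (∑ i : Fin n, c' i) := by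
        rw [hu, ← map_pow, ← map_mul, ← map_mul, monomial_pow, one_pow, monomial_mul, monomial_mul, mul_one, hexp]
      have h2 : algebraMap R L (Ideal.Quotient.mk (Ideal.span {f}) (monomial (∑ i : Fin n, c' i • a i) (1 : k))) *
          algebraMap R L u = algebraMap R L (Ideal.Quotient.mk (Ideal.span {f}) (monomial e (1 : k))) *
            algebraMap R L u ^ (∑ i : Fin n, c' i) := by
        have h := congrArg (algebraMap R L) hR
        rwa [map_mul, map_mul, map_pow] at h
      have hU1 : IsUnit (algebraMap R L u) := IsLocalization.Away.algebraMap_isUnit u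
      have hU : IsUnit (algebraMap R L u ^ (∑ i : Fin n, c' i)) := hU1.pow _
      refine ⟨monomial c' (1 : k), ?_⟩
      change Ψ (monomial c' 1) = algebraMap R L (Ideal.Quotient.mk (Ideal.span {f}) (monomial e (1 : k))) *
        IsLocalization.Away.invSelf u
      refine hU.mul_left_injective ?_
      simp only
      rw [hΨ, h1, mul_right_comm, ← h2, mul_assoc, IsLocalization.Away.mul_invSelf, mul_one]
    · rw [map_zero, zero_mul]; exact Subalgebra.zero_mem S
    · intro x y _ _ hx hy
      rw [map_add, add_mul]; exact Subalgebra.add_mem S hx hy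
    · intro r x _ hx
      rw [smul_eq_mul, map_mul, mul_assoc]
      exact Subalgebra.mul_mem S (Subalgebra.algebraMap_mem S r) hx

end Chart

end Summit.ResolutionOfSingularities.ResolutionOfSingularities.Theorems.FInjectiveMacaulayfication.MonomialChartPresentationRange

end
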